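import Summits.HodgeConjecture.HodgeConjecture.Theorems.Ring2TransportWeilTypeGeneralCMFieldSU
import Literature.AlgebraicGeometry.HodgeTheory.WeilClassesFieldRationalSpan
import HarnessLib

/-!
# Ring 2 · §transport (gen 5, θ) — the general Weil-type abelian variety over EVERY CM field: rows T6 ∪ T6-CM

HONEST FRAMING (page 1, verbatim for the whole cell). Research route conditional on `HC_CM`; not a corollary;
Q11.4-sentence-2 already refuted in dim ≥ 3 (`HodgeTheory/SemiregularityWeakCriterionAbelianCounterexample`,
`qminus_det_ne_zero`). Every statement below is a kernel-checked implication between NAMED OPEN HYPOTHESES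
(binders, never facts) or an on-path remark; `HC_CM := Theses.RankFourFaces.CMAbelianHodge`
(item stmt-HodgeConjecture-3052; this file rides `--supports stmt-HodgeConjecture-16267` = `CMToAbelian`) is an explicit
binder wherever it occurs. Fact #24 (Milne's endnote 16 to the 2003 re-edition of Deligne 1982 §4 (4.4); second locus
Milne 2025 Ex. 1.17) is UNREFEREED for `[E:ℚ] > 2` and enters only as the binder
`h24 : Deligne1982_hodgeRing_weilTypeCM_of_hodgeGroupSU`; Moonen–Zarhin's criterion only as the binder `hMZ`.

WHAT THIS FILE DOES. The cell had TWO typed "general member" targets in Weil type: row T6 (gen 3,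
`HodgeGeneralWeilType`: `E = K` imaginary quadratic, van Geemen's carriers `weilClassesOf A φ n d`, general member
`VanGeemen1994.HasHodgeGroupSU` at a `K`-symmetrised hyperplane class, Weil's theorem 6.12 REFEREED) and row T6-CM
(gen 5, `HodgeGeneralWeilTypeCMField`: Deligne's binders `IsWeilTypeCM A η R e₀ k` with `2 ≤ e₀ = [F:ℚ]`, carrier
`weilClassesField A η R(T²) (2k)`, general member `HasHodgeGroupSUCM`, fact #24). This file types the UNION in
Deligne's binders — `HodgeGeneralWeilTypeEveryCMField`: the Hodge conjecture for the general Weil-type abelian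
variety over EVERY CM field `E`, `[E:ℚ] = 2e₀ ≥ 2` — and proves:

* §1 CARRIER BRIDGE (theorem, no input): `weilClassesField A φ (T² + d) (2n) = weilClassesOf A φ n d` — Moonen–Zarhin's
  `W_E ⊗ ℂ = ⊕_σ ⋀^{2n} V_σ` at `E = ℚ(√-d)` IS van Geemen's plane `⋀^{2n} V₊ ⊕ ⋀^{2n} V₋` (the complex roots of
  `T² + d` are `± i√d`, `Deligne1982.eval₂_X_sq_add_C_eq_zero_iff`).
* §2 THE QUADRATIC MEMBERS OF DELIGNE'S BINDERS (`e₀ = 1`): `R = T + d` with `d ≥ 1` (`R` monic linear with a negative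
  real root), `dim A = 2k`, `η ≫ η = -d`; the descent input at `e₀ = 1` is van Geemen 4.9 (tree theorem
  `weilClassesOf_eq_span_isRationalClass`); hence the `e₀ = 1` SLICE
  `hodgeConjectureFor_weilTypeCM_one_of_weilClassesImaginaryQuadratic`: `#24 → MZ → R∞ → HC(A)` for every quadratic
  Weil-type `(A, η)` general at a Rosati polarization class (`k = 1`: abelian surfaces, unconditional).
* §3 THE NODE `HodgeGeneralWeilTypeEveryCMField` (@[conjecture], ours/typed target, a CASE of the summit; on-path
  `…_of_hodgeConjecture`, `…_of_hodgeAbelianVarieties`; restriction `hodgeGeneralWeilTypeCMField_of_every`) and the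
  LADDER ROW `hodgeGeneralWeilTypeEveryCMField_of_ladder : #24 → MZ → R∞ → R3 → Every` — granted Milne's endnote and
  Moonen–Zarhin's criterion, the Hodge conjecture for the general Weil-type abelian variety over every CM field follows
  from the algebraicity of the RATIONAL Weil classes (rung R∞ `WeilClassesImaginaryQuadratic` for `[E:ℚ] = 2`, rung R3
  `WeilClassesCMField` for `[E:ℚ] ≥ 4`); the descent input is DISCHARGED in both halves (vG 4.9 at `e₀ = 1`;
  `HodgeTheory.weilClassesField_le_span_isRationalClass`, §lit gen 8 p190123, at `e₀ ≥ 2`).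
* §4 TRANSPORT ROWS: `HC_GeneralWeilTypeEveryCMField_of_HC_CM : HC_CM → CMPointedWeilFamiliesQuadratic →
  WeilVariationalHodgeQuadratic → CMPointedWeilFamiliesCMField → WeilVariationalHodgeCMField → #24 → MZ → Every`
  (gen 1's R∞ / R3 rows) and its `HC_CM`-FREE twin from gen 2's divisor-generated CM-pointed leaves (`HC_CM` NOMINAL);
  `hodgeGeneralWeilTypeEveryCMField_iff` (Every ⟺ T6-CM granted #24, MZ, R∞) and `…_position`.

HONEST NOTE ON T6 (gen 3) VERSUS THE `e₀ = 1` HALF OF THIS NODE. The group binders AGREE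
(`hasHodgeGroupSUCM_X_add_C_comp_iff`: `HasHodgeGroupSUCM A η ((T + d)(T²)) h ↔ VanGeemen1994.HasHodgeGroupSU A η k d h`,
from `Deligne1982.hasHodgeGroupSUCM_iff_hasHodgeGroupSU`, p189567); the POLARIZATION binders DO NOT: T6 is stated at
van Geemen's `K`-symmetrised hyperplane class `h_a = d·e^*a + φ^*e^*a` (`a` rational, `a ≠ 0`), this node at an
abstract `IsPolarizationClass A.dim A.X h` (rational, supported on a divisor, hard Lefschetz) satisfying the Rosati
identity `Q_h(η^*x, y) = -Q_h(x, η^*y)`. Neither `IsPolarizationClass A.dim A.X h_a` (hard Lefschetz for `h_a`) nor the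
Rosati identity for `h_a` is a tree theorem, so NEITHER of `HodgeGeneralWeilType`, `HodgeGeneralWeilTypeEveryCMField|_{e₀=1}`
is shown to imply the other here; and the `e₀ = 1` half of this node routes through fact #24 (whose quadratic case is
refereed in substance — van Geemen 6.12 / Weil 1977 — but which is ONE binder covering all `e₀`), whereas T6 uses the
refereed named fact `VanGeemen1994_thm612` directly. The union row is therefore a CONVENIENCE OF STATEMENT ("every CM
field" in one set of binders), not a strengthening of T6.

What remains OPEN on the union row (all binders; labels ours/open or unrefereed): `WeilVariationalHodgeQuadratic` and
`WeilVariationalHodgeCMField` (Charles–Schnell Conj. 11.3.1 confined to flat Weil sections — the honest replacement of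
Markman's Q11.4 sentence 2), the CM-pointedness leaves (or their `HC_CM`-free divisor-generated forms), fact #24
(UNREFEREED ×2 for `[E:ℚ] > 2`), Moonen–Zarhin's criterion (refereed, named fact kept as a binder).

References: [Deligne1982HodgeCycles] §4 (4.4), Prop. 4.4, §5 and Milne's endnote 16 (2003 re-edition; UNREFEREED
addition); [Milne2025AbelianMotivesCharP] §1.5 Ex. 1.17 (arXiv:2508.09972, UNREFEREED); [MoonenZarhin1998WeilClasses]
§1 (definition of `W_F`, Lemma (1), Criterion); [vanGeemen1994HodgeAV] 4.9, Thm. 6.11–6.12; [Weil1977HodgeRing];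
[CharlesSchnell2014Notes] Conj. 11.3.1; [Markman2025SecantRealMultiplication] (arXiv:2509.23079, preprint,
UNREFEREED — statements only); [Andre2026] §4.4.4 (arXiv:2601.21052, preprint — status sentence only).
-/

noncomputable section

open CategoryTheory

namespace Summit.HodgeConjecture.HodgeConjecture.Ring2Transport

open Literature.AlgebraicGeometry Literature.AlgebraicGeometry.Motives
open Literature.AlgebraicGeometry.HodgeTheory
open Literature.AlgebraicGeometry.Deligne1982
open Literature.AlgebraicGeometry.VanGeemen1994 (pullbackOne hodgeClassSpan)
open Literature.AlgebraicTopology.SingularHomology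
open Summit.HodgeConjecture.HodgeConjecture.Theses
open Summit.HodgeConjecture.HodgeConjecture.WeilTypeLadder

set_option linter.dupNamespace false

/-! ### §1 Carrier bridge: Moonen–Zarhin's `W_E ⊗ ℂ` at `E = ℚ(√-d)` is van Geemen's Weil plane -/

section CarrierBridge

variable (A : AbelianVariety ℂ) (φ : A ⟶ A) (n d : ℕ)

/-- **`weilClassesField A φ (T² + d) (2n) = weilClassesOf A φ n d`**: the complex roots of `T² + d` are `± i√d`, and the
eigen-wedge characters `(x + y·(±i√d))^{2n}` are those of `E₊ = ⋀^{2n} V₊`, `E₋ = ⋀^{2n} V₋`. No hypothesis on `d`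
(for `d = 0` both sides are the `x^{2n}`-eigenclasses). [cite: MoonenZarhin1998WeilClasses, §1 (W_F ⊗ ℂ = ⊕_σ ⋀^r V_{ℂ,σ})]
[cite: vanGeemen1994HodgeAV, 4.9 and proof of Thm. 6.12] -/
theorem weilClassesField_X_sq_add_C_eq_weilClassesOf :
    weilClassesField A φ (Polynomial.X ^ 2 + Polynomial.C (d : ℤ)) (2 * n) = weilClassesOf A φ n d := by
  have hroots : {ρ : ℂ | Polynomial.eval₂ (Int.castRingHom ℂ) ρ
      (Polynomial.X ^ 2 + Polynomial.C (d : ℤ)) = 0} =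
      {Complex.I * (Real.sqrt d : ℂ), -(Complex.I * (Real.sqrt d : ℂ))} := by
    ext ρ
    simp only [Set.mem_setOf_eq, Set.mem_insert_iff, Set.mem_singleton_iff]
    exact eval₂_X_sq_add_C_eq_zero_iff
  rw [weilClassesField, hroots, iSup_pair, weilClassesOf, weilClassesPlus, weilClassesMinus]
  congr 2 <;> (funext x y; ring)

/-- The same in Deligne's presentation `P_R = R(T²)`, `R = T + d`. [cite: Deligne1982HodgeCycles, §4 (4.4)]
[cite: vanGeemen1994HodgeAV, 4.9] -/
theorem weilClassesField_X_add_C_comp_eq_weilClassesOf :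
    weilClassesField A φ ((Polynomial.X + Polynomial.C (d : ℤ)).comp (Polynomial.X ^ 2)) (2 * n) =
      weilClassesOf A φ n d := by
  rw [X_add_C_comp_X_sq, weilClassesField_X_sq_add_C_eq_weilClassesOf]

variable {A φ n d} in
/-- The GROUP binders of rows T6 and T6-CM agree on quadratic data: for `dim A = 2n`,
`HasHodgeGroupSUCM A φ ((T + d)(T²)) h ↔ VanGeemen1994.HasHodgeGroupSU A φ n d h` (p189567's
`hasHodgeGroupSUCM_iff_hasHodgeGroupSU` in Deligne's presentation). [cite: vanGeemen1994HodgeAV, 6.9–6.12]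
[cite: Deligne1982HodgeCycles, §4 (4.4)] -/
theorem hasHodgeGroupSUCM_X_add_C_comp_iff {h : complexBetti A.X 2} (hA : A.dim = 2 * n) :
    HasHodgeGroupSUCM A φ ((Polynomial.X + Polynomial.C (d : ℤ)).comp (Polynomial.X ^ 2)) h ↔
      VanGeemen1994.HasHodgeGroupSU A φ n d h := by
  rw [X_add_C_comp_X_sq]
  exact hasHodgeGroupSUCM_iff_hasHodgeGroupSU hA

end CarrierBridge

/-! ### §2 The quadratic members of Deligne's binders (`e₀ = 1`) -/

section Quadratic

variable {A : AbelianVariety ℂ} {η : A ⟶ A} {R : Polynomial ℤ} {k : ℕ}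

/-- Hodge type does not depend on the spelling of the dimension index (`A.dim` versus `2k`). [folklore] -/
theorem isOfHodgeType_dimIndex_congr {X : Motives.SchemeOver ℂ} {N N' j p q : ℕ} (h : N = N')
    {x : complexBetti X j} (hx : IsOfHodgeType N X j p q x) : IsOfHodgeType N' X j p q x := by
  subst h
  exact hx

/-- **`e₀ = 1` means `E` imaginary quadratic, `R = T + d` with `d ∈ ℕ`, `d ≥ 1`**: `R` is monic of degree `1`
(`Polynomial.Monic.eq_X_add_C`) and its root `-R(0)` is real NEGATIVE (`IsWeilTypeCM.root_real_neg`).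
[cite: Deligne1982HodgeCycles, §4 p. 30 (F totally real, the conjugates of η² negative)] -/
theorem exists_eq_X_add_C_of_isWeilTypeCM_one (hW : IsWeilTypeCM A η R 1 k) :
    ∃ d : ℕ, 0 < d ∧ R = Polynomial.X + Polynomial.C (d : ℤ) := by
  obtain ⟨c, hRc⟩ : ∃ c : ℤ, R = Polynomial.X + Polynomial.C c := ⟨_, hW.monic.eq_X_add_C hW.natDegree_eq⟩
  have hroot : Polynomial.eval₂ (Int.castRingHom ℂ) (-(c : ℂ)) R = 0 := by
    rw [hRc, Polynomial.eval₂_add, Polynomial.eval₂_X, Polynomial.eval₂_C, eq_intCast, neg_add_cancel]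
  have hc : 0 < c := by
    have h := (hW.root_real_neg _ hroot).2
    rw [Complex.neg_re, Complex.intCast_re, neg_lt_zero] at h
    exact_mod_cast h
  refine ⟨c.toNat, by omega, ?_⟩
  rw [hRc, Int.toNat_of_nonneg hc.le]

/-- At `e₀ = 1`, `dim A = 2k`. [cite: Deligne1982HodgeCycles, §4 p. 32] -/
theorem dim_eq_of_isWeilTypeCM_one (hW : IsWeilTypeCM A η R 1 k) : A.dim = 2 * k := by
  rw [hW.dim_eq, mul_one]

/-- At `e₀ = 1` with `R = T + d`: `η ≫ η = -d` (the tree's quadratic Weil-type relation).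
[cite: vanGeemen1994HodgeAV, 4.9] [cite: Deligne1982HodgeCycles, §4 (4.4)] -/
theorem sq_eq_of_isWeilTypeCM_one {d : ℕ} (hW : IsWeilTypeCM A η (Polynomial.X + Polynomial.C (d : ℤ)) 1 k) :
    η ≫ η = -(d • 𝟙 A) := by
  have h0 := hW.eval₂_eq_zero
  rw [X_add_C_comp_X_sq] at h0
  exact (eval₂_X_sq_add_C_End_eq_zero_iff η d).1 h0

/-- **The descent input at `e₀ = 1` is van Geemen 4.9** (tree theorem `weilClassesOf_eq_span_isRationalClass`, via the
carrier bridge of §1): no new input. [cite: vanGeemen1994HodgeAV, 4.9 (PDF p. 218)] -/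
theorem weilClassesField_le_span_isRationalClass_of_isWeilTypeCM_one (hW : IsWeilTypeCM A η R 1 k) :
    weilClassesField A η (R.comp (Polynomial.X ^ 2)) (2 * k) ≤
      Submodule.span ℂ {c | c ∈ weilClassesField A η (R.comp (Polynomial.X ^ 2)) (2 * k) ∧ IsRationalClass c} := by
  obtain ⟨d, hd, rfl⟩ := exists_eq_X_add_C_of_isWeilTypeCM_one hW
  rw [weilClassesField_X_add_C_comp_eq_weilClassesOf]
  refine (weilClassesOf_eq_span_isRationalClass hW.k_pos (dim_eq_of_isWeilTypeCM_one hW) hd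
    (sq_eq_of_isWeilTypeCM_one hW)).le.trans (Submodule.span_mono fun c hc ↦ ⟨hc.2, hc.1⟩)

/-- **The descent input at `e₀ ≥ 2` is Moonen–Zarhin §1 on the carrier** (Literature theorem
`HodgeTheory.weilClassesField_le_span_isRationalClass`, p190123, at `hW.irreducible`, `hW.eval₂_eq_zero`); recorded
for every `e₀`. [cite: MoonenZarhin1998WeilClasses, §1 (definition of W_F, Lemma (1))] -/
theorem weilClassesField_le_span_isRationalClass_of_isWeilTypeCM' {e₀ : ℕ} (hW : IsWeilTypeCM A η R e₀ k) :
    weilClassesField A η (R.comp (Polynomial.X ^ 2)) (2 * k) ≤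
      Submodule.span ℂ {c | c ∈ weilClassesField A η (R.comp (Polynomial.X ^ 2)) (2 * k) ∧ IsRationalClass c} :=
  HodgeTheory.weilClassesField_le_span_isRationalClass hW.irreducible hW.eval₂_eq_zero (2 * k)

/-- **The `e₀ = 1` slice: `#24 → MZ → R∞ → HC(A)`** for a quadratic Weil-type `(A, η, R = T + d, k)` in Deligne's
binders, general (`HasHodgeGroupSUCM`) at a Rosati polarization class. `k ≥ 2`: the slice theorem of row T6-CM
(`hodgeConjectureFor_weilTypeCM_of_rational`, valid for every `e₀`) with the descent input = van Geemen 4.9 and the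
rational `(k,k)` Weil classes algebraic by rung R∞ (`WeilClassesImaginaryQuadratic`) through the carrier bridge;
`k = 1` (Weil-type abelian SURFACES): unconditional (`hodgeConjectureFor_of_dim_le_three_holds`).
[cite: Deligne1982HodgeCycles, §4 (4.4) and Milne 2003 re-edition endnote 16] [cite: vanGeemen1994HodgeAV, 4.9, Thm. 6.12]
[cite: MoonenZarhin1998WeilClasses, §1 (Criterion)] [cite: VoisinHodgeII2003, §10.2.3] -/
theorem hodgeConjectureFor_weilTypeCM_one_of_weilClassesImaginaryQuadratic
    (h24 : Deligne1982_hodgeRing_weilTypeCM_of_hodgeGroupSU) (hMZ : MoonenZarhin1998_weilClasses_hodgeCriterion)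
    (hRq : WeilClassesImaginaryQuadratic) {h : complexBetti A.X 2} (hW : IsWeilTypeCM A η R 1 k)
    (hpol : IsPolarizationClass A.dim A.X h)
    (hRos : ∀ x y : complexBetti A.X 1,
      polarizationPairingOne A.X h (A.dim - 1) (pullbackOne A η x) y =
        -polarizationPairingOne A.X h (A.dim - 1) x (pullbackOne A η y))
    (hSU : HasHodgeGroupSUCM A η (R.comp (Polynomial.X ^ 2)) h) :
    HodgeConjectureFor A.dim A.X := by
  by_cases hk : 2 ≤ k
  · refine hodgeConjectureFor_weilTypeCM_of_rational h24 hMZ hW hpol hRos hSU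
      (weilClassesField_le_span_isRationalClass_of_isWeilTypeCM_one hW) fun c hc hcQ hcH ↦ ?_
    obtain ⟨d, hd, rfl⟩ := exists_eq_X_add_C_of_isWeilTypeCM_one hW
    rw [weilClassesField_X_add_C_comp_eq_weilClassesOf] at hc
    have hA : A.dim = 2 * k := dim_eq_of_isWeilTypeCM_one hW
    have hX : IsSmoothProjective (2 * k) A.X := by
      rw [← hA]; exact AbelianVariety.isSmoothProjective_holds (A := A)
    exact hRq k hk d hd A η hA hX (sq_eq_of_isWeilTypeCM_one hW) c hcQ (isOfHodgeType_dimIndex_congr hA hcH) hc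
  · have hA : A.dim = 2 * k := dim_eq_of_isWeilTypeCM_one hW
    exact hodgeConjectureFor_of_dim_le_three_holds (n := A.dim) (by omega)
      (AbelianVariety.isSmoothProjective_holds (A := A))

end Quadratic

/-! ### §3 The node: the general Weil-type abelian variety over EVERY CM field -/

/-- **Typed target (rows T6 ∪ T6-CM in Deligne's binders): the Hodge conjecture for the GENERAL abelian variety of
Weil type over EVERY CM field `E`, `[E:ℚ] = 2e₀ ≥ 2`.** For `(A, η, R, e₀, k)` of Weil type (`IsWeilTypeCM`: `E =
ℚ[T]/(R(T²))` a CM field, `dim_E H¹ = 2k`, every embedding of multiplicity `k` on `H^{1,0}`), a polarization class `h`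
with the Rosati identity `Q_h(η^*x, y) = -Q_h(x, η^*y)` at which the degree-one Hodge group IS `SU(φ)(ℂ)`
(`HasHodgeGroupSUCM`: the general member of the Weil family), `HodgeConjectureFor A.dim A.X`. Ours / typed target
(no new conjecture in print is asserted): ON-PATH, a CASE of `HC_AV` and of the summit; it restricts to row T6-CM
(`HodgeGeneralWeilTypeCMField`, `2 ≤ e₀`) and its `e₀ = 1` half is the quadratic case in Deligne's binders (see the
module docstring for its relation to gen 3's `HodgeGeneralWeilType`). STATUS in print: OPEN for every CM field of
degree `≥ 4` (Deligne §4–5; André, arXiv:2601.21052, §4.4.4, preprint: for `E⁺ ≠ ℚ` the Weil classes are not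
known to be algebraic);
for `E` imaginary quadratic known for `k ≤ 2` in special discriminants / `det = 1` and `k = 3`, `K = ℚ(√-3)` (Schoen,
van Geemen 7.3, Markman JEMS 2023), OPEN otherwise; Markman's arXiv:2509.23079 announces degree-4 cases (UNREFEREED).
[cite: Deligne1982HodgeCycles, §4 (4.4), Prop. 4.4, §5 and Milne 2003 re-edition endnote 16]
[cite: vanGeemen1994HodgeAV, Thm. 6.11–6.12, 7.3] [cite: MoonenZarhin1998WeilClasses, §1]
[cite: Markman2025SecantRealMultiplication, §1 (preprint, unrefereed)] [cite: Andre2026, §4.4.4 (preprint)] [status: open] -/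
@[conjecture] def HodgeGeneralWeilTypeEveryCMField : Prop :=
  ∀ (A : AbelianVariety ℂ) (η : A ⟶ A) (R : Polynomial ℤ) (e₀ k : ℕ) (h : complexBetti A.X 2),
    IsWeilTypeCM A η R e₀ k → IsPolarizationClass A.dim A.X h →
    (∀ x y : complexBetti A.X 1,
      polarizationPairingOne A.X h (A.dim - 1) (pullbackOne A η x) y =
        -polarizationPairingOne A.X h (A.dim - 1) x (pullbackOne A η y)) →
    HasHodgeGroupSUCM A η (R.comp (Polynomial.X ^ 2)) h → HodgeConjectureFor A.dim A.X

/-- ON-PATH (C6): the node is a case of the summit. [cite: Deligne2000, §1] -/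
theorem hodgeGeneralWeilTypeEveryCMField_of_hodgeConjecture (hHC : _root_.HodgeConjecture) :
    HodgeGeneralWeilTypeEveryCMField :=
  fun A _ _ _ _ _ _ _ _ _ ↦ hHC (AbelianVariety.isSmoothProjective_holds (A := A))

/-- ON-PATH: the node is a case of `HC_AV` (`Theses.PadicSemiregularLift.HodgeAbelianVarieties`,
stmt-HodgeConjecture-1333). [cite: Deligne2000, §1] -/
theorem hodgeGeneralWeilTypeEveryCMField_of_hodgeAbelianVarieties
    (hAV : PadicSemiregularLift.HodgeAbelianVarieties) : HodgeGeneralWeilTypeEveryCMField :=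
  fun A _ _ _ _ _ _ _ _ _ ↦ hAV A

/-- Restriction to `[E:ℚ] ≥ 4`: the node contains row T6-CM. [cite: Deligne1982HodgeCycles, §4 (4.4)] -/
theorem hodgeGeneralWeilTypeCMField_of_every (hE : HodgeGeneralWeilTypeEveryCMField) :
    HodgeGeneralWeilTypeCMField :=
  fun A η R e₀ k h _ hW hpol hRos hSU ↦ hE A η R e₀ k h hW hpol hRos hSU

/-- **Every ⟸ (quadratic inputs) ∧ T6-CM**: granted #24, MZ and rung R∞, the node is row T6-CM plus its `e₀ = 1`
slice (§2). [cite: Deligne1982HodgeCycles, §4 (4.4) and Milne 2003 re-edition endnote 16] [cite: vanGeemen1994HodgeAV, Thm. 6.12] -/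
theorem hodgeGeneralWeilTypeEveryCMField_of_quadraticLadder_of_cmField
    (h24 : Deligne1982_hodgeRing_weilTypeCM_of_hodgeGroupSU) (hMZ : MoonenZarhin1998_weilClasses_hodgeCriterion)
    (hRq : WeilClassesImaginaryQuadratic) (hT : HodgeGeneralWeilTypeCMField) :
    HodgeGeneralWeilTypeEveryCMField := by
  intro A η R e₀ k h hW hpol hRos hSU
  by_cases he : 2 ≤ e₀
  · exact hT A η R e₀ k h he hW hpol hRos hSU
  · obtain rfl : e₀ = 1 := by have := hW.e₀_pos; omega
    exact hodgeConjectureFor_weilTypeCM_one_of_weilClassesImaginaryQuadratic h24 hMZ hRq hW hpol hRos hSU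

/-- **Exactness of the split (granted #24, MZ, R∞): Every ⟺ T6-CM.** [cite: Deligne1982HodgeCycles, §4 (4.4)]
[cite: vanGeemen1994HodgeAV, Thm. 6.12] -/
theorem hodgeGeneralWeilTypeEveryCMField_iff
    (h24 : Deligne1982_hodgeRing_weilTypeCM_of_hodgeGroupSU) (hMZ : MoonenZarhin1998_weilClasses_hodgeCriterion)
    (hRq : WeilClassesImaginaryQuadratic) :
    HodgeGeneralWeilTypeEveryCMField ↔ HodgeGeneralWeilTypeCMField :=
  ⟨hodgeGeneralWeilTypeCMField_of_every, hodgeGeneralWeilTypeEveryCMField_of_quadraticLadder_of_cmField h24 hMZ hRq⟩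

/-- **LADDER ROW: `#24 → MZ → R∞ → R3 → Every`.** Granted Milne's endnote (UNREFEREED for `[E:ℚ] > 2`) and
Moonen–Zarhin's criterion, the Hodge conjecture for the general Weil-type abelian variety over EVERY CM field follows
from the algebraicity of the RATIONAL Weil classes: rung R∞ (`WeilClassesImaginaryQuadratic`) for `[E:ℚ] = 2`, rung R3
(`WeilClassesCMField`) for `[E:ℚ] ≥ 4` (`weilClassesCMField_isWeilTypeCM`: Deligne's binders supply R3's seven
hypotheses). The descent input is DISCHARGED in both halves (vG 4.9; MZ §1 on the carrier, p190123). NO families, NO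
`HC_CM`. [cite: Deligne1982HodgeCycles, §4 (4.4), Prop. 4.4 and Milne 2003 re-edition endnote 16]
[cite: MoonenZarhin1998WeilClasses, §1 (Lemma (1), Criterion)] [cite: vanGeemen1994HodgeAV, 4.9, Thm. 6.12] -/
theorem hodgeGeneralWeilTypeEveryCMField_of_ladder
    (h24 : Deligne1982_hodgeRing_weilTypeCM_of_hodgeGroupSU) (hMZ : MoonenZarhin1998_weilClasses_hodgeCriterion)
    (hRq : WeilClassesImaginaryQuadratic) (hR3 : WeilClassesCMField) : HodgeGeneralWeilTypeEveryCMField :=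
  hodgeGeneralWeilTypeEveryCMField_of_quadraticLadder_of_cmField h24 hMZ hRq
    fun _ _ _ _ _ _ he hW hpol hRos hSU ↦
      hodgeConjectureFor_weilTypeCM_of_rational h24 hMZ hW hpol hRos hSU
        (weilClassesField_le_span_isRationalClass_of_isWeilTypeCM' hW) (weilClassesCMField_isWeilTypeCM hR3 he hW)

/-! ### §4 Transport rows -/

/-- **Row T6 ∪ T6-CM, transport form: `HC_CM → CMPointedWeilFamiliesQuadratic → WeilVariationalHodgeQuadratic →
CMPointedWeilFamiliesCMField → WeilVariationalHodgeCMField → (#24) → (MZ) → HodgeGeneralWeilTypeEveryCMField`.**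
`HC_CM` makes the CM members of the CM-pointed Weil families algebraic anchors; the Weil-confined variational Hodge
conjectures (OURS/OPEN: Charles–Schnell Conj. 11.3.1 confined to flat Weil sections — the honest replacement of
Markman's Q11.4 sentence 2, refuted in dim ≥ 3) transport algebraicity to every member (gen 1: rungs R∞ and R3,
`HC_WeilClassesQuadratic_of_HC_CM`, `HC_WeilClassesCMField_of_HC_CM`); the ladder row (§3) finishes. CONDITIONAL on
the seven named binders; `HC_CM` NOMINAL (next). [cite: CharlesSchnell2014Notes, Conj. 11.3.1]
[cite: Deligne1982HodgeCycles, §4 (4.4) and Milne 2003 re-edition endnote 16] [cite: MoonenZarhin1998WeilClasses, §1] -/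
theorem HC_GeneralWeilTypeEveryCMField_of_HC_CM (hCM : Theses.RankFourFaces.CMAbelianHodge)
    (hPq : CMPointedWeilFamiliesQuadratic) (hVq : WeilVariationalHodgeQuadratic)
    (hP : CMPointedWeilFamiliesCMField) (hV : WeilVariationalHodgeCMField)
    (h24 : Deligne1982_hodgeRing_weilTypeCM_of_hodgeGroupSU) (hMZ : MoonenZarhin1998_weilClasses_hodgeCriterion) :
    HodgeGeneralWeilTypeEveryCMField :=
  hodgeGeneralWeilTypeEveryCMField_of_ladder h24 hMZ (HC_WeilClassesQuadratic_of_HC_CM hCM hPq hVq)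
    (HC_WeilClassesCMField_of_HC_CM hCM hP hV)

/-- **The same WITHOUT `HC_CM`** (load-bearing audit): the divisor-generated CM-pointed leaves of gen 2 (diagonal CM
members `E_Kⁿ × E_Kⁿ`, resp. divisor-generated CM members over a CM field, on which `Hdg = Div`) replace the
`HC_CM`-anchors — on the union row `HC_CM` is NOMINAL. [cite: vanGeemen1994HodgeAV, 2.4] [cite: Deligne1982HodgeCycles, §5]
[cite: CharlesSchnell2014Notes, Conj. 11.3.1] -/
theorem HC_GeneralWeilTypeEveryCMField_of_divisorGeneratedCMPointed
    (hPq : DivisorGeneratedCMPointedWeilFamiliesQuadratic) (hVq : WeilVariationalHodgeQuadratic)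
    (hP : DivisorGeneratedCMPointedWeilFamiliesCMField) (hV : WeilVariationalHodgeCMField)
    (h24 : Deligne1982_hodgeRing_weilTypeCM_of_hodgeGroupSU) (hMZ : MoonenZarhin1998_weilClasses_hodgeCriterion) :
    HodgeGeneralWeilTypeEveryCMField :=
  hodgeGeneralWeilTypeEveryCMField_of_ladder h24 hMZ (HC_WeilClassesQuadratic_of_divisorGeneratedCMPointed hPq hVq)
    (HC_WeilClassesCMField_of_divisorGeneratedCMPointed hP hV)

/-- **Where the union node sits**: `HC_AV ⟹ Every ⟹ T6-CM`; `Every ⟸ R∞ ∧ R3` granted ONLY #24 and MZ; and under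
`HC_CM` with the four transport leaves. Honest reading: "`HC_CM` nominal; content = the two Weil-confined variational
Hodge statements (ours/open) + Milne's endnote (unrefereed for `[E:ℚ] > 2`) + Moonen–Zarhin's criterion (refereed)";
the descent inputs are theorems. [cite: Deligne1982HodgeCycles, §4–§5 and Milne 2003 re-edition endnote 16]
[cite: MoonenZarhin1998WeilClasses, §1] [cite: vanGeemen1994HodgeAV, Thm. 6.12] -/
theorem hodgeGeneralWeilTypeEveryCMField_position :
    (PadicSemiregularLift.HodgeAbelianVarieties → HodgeGeneralWeilTypeEveryCMField) ∧
    (HodgeGeneralWeilTypeEveryCMField → HodgeGeneralWeilTypeCMField) ∧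
    (Deligne1982_hodgeRing_weilTypeCM_of_hodgeGroupSU → MoonenZarhin1998_weilClasses_hodgeCriterion →
      WeilClassesImaginaryQuadratic → WeilClassesCMField → HodgeGeneralWeilTypeEveryCMField) ∧
    (Theses.RankFourFaces.CMAbelianHodge → CMPointedWeilFamiliesQuadratic → WeilVariationalHodgeQuadratic →
      CMPointedWeilFamiliesCMField → WeilVariationalHodgeCMField →
      Deligne1982_hodgeRing_weilTypeCM_of_hodgeGroupSU → MoonenZarhin1998_weilClasses_hodgeCriterion →
      HodgeGeneralWeilTypeEveryCMField) :=
  ⟨hodgeGeneralWeilTypeEveryCMField_of_hodgeAbelianVarieties, hodgeGeneralWeilTypeCMField_of_every,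
    hodgeGeneralWeilTypeEveryCMField_of_ladder, HC_GeneralWeilTypeEveryCMField_of_HC_CM⟩

end Summit.HodgeConjecture.HodgeConjecture.Ring2Transport
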